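import Summits.RiemannHypothesis.RiemannHypothesis.Theorems.HandoffEdgeAsymptotic
import HarnessLib

/-!
# HANDOFF, edge block: the asymptotic converse for EVERY Cramér constant `c < 1` (rh-explicit, track «HANDOFF», seat prove-2 gen3, ATTEMPT-8 §3)

HONEST FRAMING. Nothing here bears on the truth of RH. Continuation of `HandoffEdgeAsymptotic.lean` (constant `½`,
`q ≥ e⁸⁰`): the same method with the `c`-dependence kept.

* `handoffCrossConst_le_of_gap_le'` — under `q′ − q ≤ c·√q·log q` (`c ≤ 1`, `q ≥ e⁸⁰`): `X ≤ (c/2)·log q + 6.1154`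
  (`√q′ ≤ (1 + 192/ℓ³)√q` from `ℓ⁴ ≤ 384·√q`, `ℓ = log q`) (PROVED).
* `lobeCoercivity_ge_of_level'` — at `K = √q/ℓ²`: `lobeCoercivity ≥ ℓ/2 − 2 log ℓ − 3.2243` (PROVED).
* `edgeNonneg_of_gap_le'` — **for every `c`, `4 log log q + 19 ≤ (1 − c) log q` and `q′ − q ≤ c√q log q` give
  `EdgeNonneg q q′ η`** (`q ≥ e⁸⁰`, `0 < η ≤ 1/(4q)`) (PROVED); `edgeNonneg_of_gap_le_of_exp_le` — the threshold form
  `q ≥ exp(144/(1 − c)²)` (PROVED).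

So the SUFFICIENT Cramér constant of the edge block tends to `1⁻` — ATTEMPT-7 §3's numerical `g_suff(q) = (1 − o(1))√q log q`
is now a theorem — while the NECESSARY one is `cramerGapConst` (`HandoffCramer.lean`; numerically `≈ 1.1–1.7` by profile,
ATTEMPT-7). The method stops exactly at `c = 1`, where the polar cross mass `(c/2)·log q` of two mirror lobes reaches
the lobe level `log K ≈ ½ log q`; whether the true threshold constant is `1` is a Beurling–Selberg-type extremal
problem (Carneiro–Milinovich–Soundararajan 2019 solve the analogous one for RH ⇒ Cramér with `22/25`), not settled here.
-/

set_option linter.dupNamespace false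

noncomputable section

open Complex Filter Set MeasureTheory Literature.NumberTheory.LFunctions
open scoped Real Topology ComplexConjugate ContDiff

namespace Summit.RiemannHypothesis.RiemannHypothesis.Theorems.Handoff

variable {q q' : ℕ}

/-! ## §1 Estimates with the `c`-dependence kept -/

/-- `(log x)⁴ ≤ 384·√x` for `x ≥ 1` (`u⁴/4! ≤ eᵘ` at `u = (log x)/2`). [folklore] -/
theorem log_pow_four_le_sqrt {x : ℝ} (hx : 1 ≤ x) : Real.log x ^ 4 ≤ 384 * Real.sqrt x := by
  have hx0 : 0 < x := by linarith
  have hl : 0 ≤ Real.log x := Real.log_nonneg hx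
  have h := Real.pow_div_factorial_le_exp (Real.log x / 2) (by linarith) 4
  have h4 : (Nat.factorial 4 : ℝ) = 24 := by norm_num [Nat.factorial]
  rw [h4, div_le_iff₀ (by norm_num : (0:ℝ) < 24)] at h
  have hexp : Real.exp (Real.log x / 2) = Real.sqrt x := by
    have h3 : Real.exp (Real.log x / 2) * Real.exp (Real.log x / 2) = x := by
      rw [← Real.exp_add, add_halves, Real.exp_log hx0]
    rw [← Real.sqrt_mul_self (Real.exp_pos (Real.log x / 2)).le, h3]
  rw [hexp] at h
  nlinarith [h]

/-- `√x ≥ 1000` for `x ≥ e⁸⁰`. [folklore] -/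
theorem thousand_le_sqrt_of_exp_eighty_le {x : ℝ} (hx : Real.exp 80 ≤ x) : (1000 : ℝ) ≤ Real.sqrt x := by
  have e : Real.sqrt (Real.exp 80) = Real.exp 40 := by
    rw [show (80 : ℝ) = 40 + 40 by norm_num, Real.exp_add, Real.sqrt_mul_self (Real.exp_pos 40).le]
  have h1 : Real.exp 40 ≤ Real.sqrt x := by rw [← e]; exact Real.sqrt_le_sqrt hx
  exact (exp_seven_ge.trans (Real.exp_le_exp.2 (by norm_num))).trans h1

/-- The overlap is invisible at this scale: `η ≤ 1/(4x)` and `√x ≥ 1000` give `η·√x ≤ 0.00025`. [folklore] -/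
theorem eta_mul_sqrt_le {x η : ℝ} (hx : 0 < x) (h1000 : (1000 : ℝ) ≤ Real.sqrt x) (hηx : η ≤ 1 / (4 * x)) :
    η * Real.sqrt x ≤ 0.00025 := by
  have hsq : 0 < Real.sqrt x := Real.sqrt_pos.2 hx
  have hsqsq : Real.sqrt x * Real.sqrt x = x := Real.mul_self_sqrt hx.le
  have h1 : η * Real.sqrt x ≤ 1 / (4 * x) * Real.sqrt x := mul_le_mul_of_nonneg_right hηx hsq.le
  have h2 : 1 / (4 * x) * Real.sqrt x ≤ 0.00025 := by
    rw [div_mul_eq_mul_div, one_mul, div_le_iff₀ (by positivity)]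
    have h3 : 1000 * Real.sqrt x ≤ Real.sqrt x * Real.sqrt x := mul_le_mul_of_nonneg_right h1000 hsq.le
    rw [hsqsq] at h3
    linarith
  exact h1.trans h2

/-- The gap in logarithmic scale: `q′ − q ≤ c·√q·log q` gives `log q′ − log q ≤ c·log q/√q` (`log(1+u) ≤ u`). [folklore] -/
theorem log_sub_log_le_of_gap {x y c : ℝ} (hx : 0 < x) (hxy : x < y) (hgap : y - x ≤ c * Real.sqrt x * Real.log x) :
    Real.log y - Real.log x ≤ c * Real.log x / Real.sqrt x := by
  have hy : 0 < y := hx.trans hxy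
  have hsq : 0 < Real.sqrt x := Real.sqrt_pos.2 hx
  have hsqsq : Real.sqrt x * Real.sqrt x = x := Real.mul_self_sqrt hx.le
  have h1 : Real.log y - Real.log x = Real.log (y / x) := by rw [Real.log_div hy.ne' hx.ne']
  have h2 : Real.log (y / x) ≤ y / x - 1 := Real.log_le_sub_one_of_pos (div_pos hy hx)
  have h3 : y / x - 1 = (y - x) / x := by field_simp
  have h4 : (y - x) / x ≤ c * Real.log x / Real.sqrt x := by
    rw [div_le_div_iff₀ hx hsq]
    have h5 : c * Real.sqrt x * Real.log x * Real.sqrt x = c * Real.log x * (Real.sqrt x * Real.sqrt x) := by ring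
    rw [hsqsq] at h5
    have h6 : (y - x) * Real.sqrt x ≤ c * Real.sqrt x * Real.log x * Real.sqrt x :=
      mul_le_mul_of_nonneg_right hgap hsq.le
    linarith [h5.le, h5.ge, h6]
  linarith [h1.ge, h2, h3.le, h4]

/-- **Lobe coercivity at a high level, parametric form.** If `ℓ ≥ 80`, `0 ≤ D ≤ 0.0024`, `K ≥ 2` with
`log K = ℓ/2 − 2 log ℓ` and `D·K ≤ 1/(2ℓ) + 0.00025/ℓ²`, then `lobeCoercivity D K ≥ ℓ/2 − 2 log ℓ − 3.2243`
(the level term `(DK/π)(L_K + 4.2275) ≤ (¼ + 3.5344/(2ℓ) + …)/π ≤ 0.0867`). [cite: Bombieri2000, §12 eqs. (12.3)–(12.9); this track, ATTEMPT-8 §3] -/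
theorem lobeCoercivity_ge_of_level' {ℓ D K : ℝ} (hℓ : 80 ≤ ℓ) (hD0 : 0 ≤ D) (hD : D ≤ 0.0024) (hK : 2 ≤ K)
    (hlogK : Real.log K = ℓ / 2 - 2 * Real.log ℓ) (hDK : D * K ≤ 1 / (2 * ℓ) + 0.00025 / ℓ ^ 2) :
    ℓ / 2 - 2 * Real.log ℓ - 3.2243 ≤ lobeCoercivity D K := by
  have hL := weilLevel_bounds hK
  have hℓ0 : 0 < ℓ := by linarith
  have hlogℓ : 0 ≤ Real.log ℓ := Real.log_nonneg (by linarith)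
  have hDlog2 : D / 2 ≤ Real.log 2 / 2 := by have := Real.log_two_gt_d9; linarith
  have hsinh : 2 * (Real.sinh (D / 2) - D / 2) ≤ 0.0142 := two_mul_sinh_sub_le hDlog2
  have hlpi := Literature.Analysis.SpecialFunctions.Real.log_pi_le
  have hterm : D * K / π * (weilLevel K + 4.22745354) ≤ 0.0867 := by
    have hpos : 0 ≤ weilLevel K + 4.22745354 := by
      have : 0 ≤ Real.log K := Real.log_nonneg (by linarith)
      linarith [hL.1]
    have hup : weilLevel K + 4.22745354 ≤ ℓ / 2 + 3.5344 := by linarith [hL.2, hlogK, hlogℓ]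
    have hDK0 : 0 ≤ D * K := mul_nonneg hD0 (by linarith)
    -- (DK)(L_K + 4.23) ≤ (1/(2ℓ) + 0.00025/ℓ²)(ℓ/2 + 3.5344) ≤ 0.2721
    have hprod : D * K * (weilLevel K + 4.22745354) ≤ 0.2721 := by
      have h1 : D * K * (weilLevel K + 4.22745354) ≤ (1 / (2 * ℓ) + 0.00025 / ℓ ^ 2) * (ℓ / 2 + 3.5344) :=
        mul_le_mul hDK hup hpos (by positivity)
      have h2 : (1 / (2 * ℓ) + 0.00025 / ℓ ^ 2) * (ℓ / 2 + 3.5344) =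
          1 / 4 + 3.5344 / (2 * ℓ) + 0.000125 / ℓ + 0.00025 * 3.5344 / ℓ ^ 2 := by
        field_simp
        ring
      have h3 : 3.5344 / (2 * ℓ) ≤ 3.5344 / 160 := div_le_div_of_nonneg_left (by norm_num) (by norm_num) (by linarith)
      have h4 : 0.000125 / ℓ ≤ 0.000125 / 80 := div_le_div_of_nonneg_left (by norm_num) (by norm_num) hℓ
      have h5 : 0.00025 * 3.5344 / ℓ ^ 2 ≤ 0.00025 * 3.5344 / 6400 :=
        div_le_div_of_nonneg_left (by norm_num) (by norm_num) (by nlinarith)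
      linarith [h1, h2.le, h3, h4, h5]
    rw [div_mul_eq_mul_div, div_le_iff₀ Real.pi_pos]
    nlinarith [Real.pi_gt_d6, hprod]
  unfold lobeCoercivity
  linarith [hL.1, hlogK, hsinh, hlpi, hterm]

/-- **The cross constant under a gap `≤ c·√q·log q`, any `c ≤ 1`.** For consecutive primes `q < q′` with `q ≥ e⁸⁰`,
`q′ − q ≤ c·√q·log q`, `0 < η ≤ 1/(4q)` and `b` in the window: `handoffCrossConst q η b ≤ (c/2)·log q + 6.1154`
(`e^b ≤ √q′ ≤ (1 + 192/ℓ³)√q` from `ℓ⁴ ≤ 384√q`, `D ≤ cℓ/(2√q) + η`, so `e^b·D ≤ cℓ/2 + 96/ℓ² + 1.001·η√q`; `X_ev ≤ 6.1`).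
[this track, ATTEMPT-8 §3] -/
theorem handoffCrossConst_le_of_gap_le' (hcons : ConsecutivePrimes q q') (hq : Real.exp 80 ≤ q) {c : ℝ} (hc : c ≤ 1)
    (hgap : (q' : ℝ) - q ≤ c * Real.sqrt q * Real.log q) {η b : ℝ} (hη : 0 < η) (hηq : η ≤ 1 / (4 * q))
    (hb : b ∈ Icc (Real.log q / 2) (Real.log q' / 2)) :
    handoffCrossConst q η b ≤ c / 2 * Real.log q + 6.1154 := by
  have hq0 : (0 : ℝ) < q := by exact_mod_cast hcons.1.pos
  have hqq' : (q : ℝ) < q' := by exact_mod_cast hcons.2.2.1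
  have hq'0 : (0 : ℝ) < q' := hq0.trans hqq'
  have hℓ80 : 80 ≤ Real.log q := by rw [Real.le_log_iff_exp_le hq0]; exact hq
  have hℓ0 : 0 < Real.log q := by linarith
  have h16 : Real.exp 16 ≤ q := (Real.exp_le_exp.2 (by norm_num)).trans hq
  have h7 : (10 : ℝ) ^ 7 ≤ q :=
    ten_pow_seven_le_exp_seventeen.trans ((Real.exp_le_exp.2 (by norm_num)).trans hq)
  have hsq : 0 < Real.sqrt q := Real.sqrt_pos.2 hq0
  have hsqsq : Real.sqrt q * Real.sqrt q = q := Real.mul_self_sqrt hq0.le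
  have hsq1000 : (1000 : ℝ) ≤ Real.sqrt q := thousand_le_sqrt_of_exp_eighty_le hq
  have hg0 : 0 ≤ c * Real.sqrt q * Real.log q := by linarith
  have hc0 : 0 ≤ c := by
    by_contra h
    rw [not_le] at h
    have h1 : 0 < Real.sqrt q * Real.log q := mul_pos hsq hℓ0
    have h2 : c * (Real.sqrt q * Real.log q) < 0 := mul_neg_of_neg_of_pos h h1
    have h3 : c * Real.sqrt q * Real.log q = c * (Real.sqrt q * Real.log q) := by ring
    linarith [h2, h3.le]
  set ℓ : ℝ := Real.log q with hℓ
  have hq1 : (1 : ℝ) ≤ q := by linarith [Real.one_le_exp (by norm_num : (0:ℝ) ≤ 16), h16]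
  have hℓ4 : ℓ ^ 4 ≤ 384 * Real.sqrt q := log_pow_four_le_sqrt hq1
  have hℓ3 : 0 < ℓ ^ 3 := by positivity
  have hℓsq : ℓ * Real.sqrt q ≤ 384 / ℓ ^ 3 * q := by
    rw [div_mul_eq_mul_div, le_div_iff₀ hℓ3]
    have : ℓ * Real.sqrt q * ℓ ^ 3 = ℓ ^ 4 * Real.sqrt q := by ring
    rw [this]
    calc ℓ ^ 4 * Real.sqrt q ≤ 384 * Real.sqrt q * Real.sqrt q := mul_le_mul_of_nonneg_right hℓ4 hsq.le
      _ = 384 * q := by rw [mul_assoc, hsqsq]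
  have hηsq : η * Real.sqrt q ≤ 0.00025 := eta_mul_sqrt_le hq0 hsq1000 hηq
  have hlogdiff : Real.log q' - ℓ ≤ c * ℓ / Real.sqrt q := log_sub_log_le_of_gap hq0 hqq' hgap
  have hq'le : (q' : ℝ) ≤ (1 + 384 / ℓ ^ 3) * q := by
    have h1 : c * Real.sqrt q * ℓ ≤ 1 * Real.sqrt q * ℓ :=
      mul_le_mul_of_nonneg_right (mul_le_mul_of_nonneg_right hc hsq.le) hℓ0.le
    have h2 : 1 * Real.sqrt q * ℓ = ℓ * Real.sqrt q := by ring
    have h3 : (1 + 384 / ℓ ^ 3) * (q : ℝ) = q + 384 / ℓ ^ 3 * q := by ring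
    linarith [hgap, hℓsq, h1, h2.le, h3.ge]
  have hsq' : Real.sqrt q' ≤ (1 + 192 / ℓ ^ 3) * Real.sqrt q := by
    have hpos : 0 ≤ 1 + 192 / ℓ ^ 3 := by positivity
    refine Real.sqrt_le_iff.2 ⟨by positivity, ?_⟩
    have h1 : ((1 + 192 / ℓ ^ 3) * Real.sqrt q) ^ 2 = (1 + 192 / ℓ ^ 3) ^ 2 * (Real.sqrt q * Real.sqrt q) := by ring
    have h2 : 1 + 384 / ℓ ^ 3 ≤ (1 + 192 / ℓ ^ 3) ^ 2 := by
      have e : (1 + 192 / ℓ ^ 3) ^ 2 = 1 + 384 / ℓ ^ 3 + (192 / ℓ ^ 3) ^ 2 := by ring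
      rw [e]
      linarith [sq_nonneg (192 / ℓ ^ 3)]
    rw [h1, hsqsq]
    nlinarith [hq'le, h2, hq0]
  set c' : ℝ := Real.log q / 2 - η with hc'
  set D : ℝ := b - c' with hD_def
  have hD0 : 0 ≤ D := by simp only [hD_def, hc']; linarith [hb.1]
  have hDle : D ≤ c * ℓ / (2 * Real.sqrt q) + η := by
    simp only [hD_def, hc']
    have : c * ℓ / (2 * Real.sqrt q) = c * ℓ / Real.sqrt q / 2 := by ring
    linarith [hb.2, hlogdiff]
  have h512 : (512000 : ℝ) ≤ ℓ ^ 3 := by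
    have := pow_le_pow_left₀ (by norm_num) hℓ80 3
    linarith [this]
  have hcℓsq : c * ℓ / (2 * Real.sqrt q) ≤ 0.0004 := by
    rw [div_le_iff₀ (by positivity)]
    have h1 : c * ℓ ≤ 1 * ℓ := mul_le_mul_of_nonneg_right hc hℓ0.le
    have h2 : (512000 : ℝ) * ℓ ≤ ℓ ^ 4 := by
      calc (512000 : ℝ) * ℓ ≤ ℓ ^ 3 * ℓ := mul_le_mul_of_nonneg_right h512 hℓ0.le
        _ = ℓ ^ 4 := by ring
    linarith [h1, h2, hℓ4]
  have hηsmall : η ≤ 0.001 := by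
    have : (1 : ℝ) / (4 * q) ≤ 0.001 := by
      rw [div_le_iff₀ (by positivity)]; linarith [h7]
    exact hηq.trans this
  have hDsmall : D ≤ 0.0024 := by linarith
  have hXev := handoffCrossConstEven_le_of_large hcons h7 hη hηq hb
  have hsplit : handoffCrossConst q η b = (Real.exp b + Real.exp (-c')) * D + handoffCrossConstEven q η b := by
    simp only [handoffCrossConst, handoffCrossConstEven, hD_def, hc']; ring
  have heb : Real.exp b ≤ (1 + 192 / ℓ ^ 3) * Real.sqrt q := by
    have h1 : Real.exp b ≤ Real.exp (Real.log q' / 2) := Real.exp_le_exp.2 hb.2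
    have h3 : Real.exp (Real.log q' / 2) * Real.exp (Real.log q' / 2) = q' := by
      rw [← Real.exp_add, add_halves, Real.exp_log hq'0]
    have h2 : Real.exp (Real.log q' / 2) = Real.sqrt q' := by
      rw [← Real.sqrt_mul_self (Real.exp_pos (Real.log q' / 2)).le, h3]
    linarith [h1, h2.le, hsq']
  have hec' : Real.exp (-c') ≤ 0.001 := by
    have h1 : 7 ≤ c' := by simp only [hc']; linarith
    have h2 : Real.exp (-c') ≤ Real.exp (-7) := Real.exp_le_exp.2 (by linarith)
    have h3 : Real.exp (-7) * Real.exp 7 = 1 := by rw [← Real.exp_add]; norm_num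
    nlinarith [exp_seven_ge, Real.exp_pos (-7)]
  have hpolar : (Real.exp b + Real.exp (-c')) * D ≤ c / 2 * ℓ + 0.0154 := by
    have hA0 : 0 ≤ 1 + 192 / ℓ ^ 3 := by positivity
    have h1 : Real.exp b * D ≤ (1 + 192 / ℓ ^ 3) * Real.sqrt q * D := mul_le_mul_of_nonneg_right heb hD0
    have h2 : Real.sqrt q * D ≤ c * ℓ / 2 + 0.00025 := by
      have h3 : Real.sqrt q * D ≤ Real.sqrt q * (c * ℓ / (2 * Real.sqrt q) + η) :=
        mul_le_mul_of_nonneg_left hDle hsq.le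
      have h4 : Real.sqrt q * (c * ℓ / (2 * Real.sqrt q) + η) = c * ℓ / 2 + η * Real.sqrt q := by
        field_simp
      linarith [h3, h4.le, hηsq]
    have h2' : (1 + 192 / ℓ ^ 3) * Real.sqrt q * D ≤ (1 + 192 / ℓ ^ 3) * (c * ℓ / 2 + 0.00025) := by
      rw [mul_assoc]; exact mul_le_mul_of_nonneg_left h2 hA0
    -- (1 + 192/ℓ³)(cℓ/2 + 0.00025) = cℓ/2 + 96c/ℓ² + (1 + 192/ℓ³)·0.00025 ≤ cℓ/2 + 0.015 + 0.00026
    have h6 : 192 / ℓ ^ 3 ≤ 192 / 512000 := div_le_div_of_nonneg_left (by norm_num) (by norm_num) h512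
    have h7' : 192 / ℓ ^ 3 * (c * ℓ / 2) ≤ 0.015 := by
      have e : 192 / ℓ ^ 3 * (c * ℓ / 2) = 96 * c / ℓ ^ 2 := by field_simp; ring
      rw [e, div_le_iff₀ (by positivity)]
      have h6400 : (6400 : ℝ) ≤ ℓ ^ 2 := by
        have := pow_le_pow_left₀ (by norm_num) hℓ80 2
        linarith [this]
      linarith [hc, h6400]
    have h5 : Real.exp (-c') * D ≤ 0.001 * 0.0024 := mul_le_mul hec' hDsmall hD0 (by norm_num)
    have hexpand : (1 + 192 / ℓ ^ 3) * (c * ℓ / 2 + 0.00025) =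
        c * ℓ / 2 + 192 / ℓ ^ 3 * (c * ℓ / 2) + (1 + 192 / ℓ ^ 3) * 0.00025 := by ring
    rw [add_mul]
    linarith [h1, h2', h5, h6, h7', hexpand]
  rw [hsplit]
  linarith [hpolar, hXev]

/-! ## §2 The edge block for every `c < 1` -/

/-- **The edge block from a gap `≤ c·√q·log q`, every `c < 1`.** For consecutive primes `q < q′` with `q ≥ e⁸⁰`,
a constant `c` with `4·log log q + 19 ≤ (1 − c)·log q`, a gap `q′ − q ≤ c·√q·log q` and an overlap `0 < η ≤ 1/(4q)`:
`EdgeNonneg q q′ η`. Same proof as `edgeNonneg_of_gap_le` with the `c`-dependence kept: cross constant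
`≤ (c/2)ℓ + 6.1154`, lobe coercivity at `K = √q/ℓ²` `≥ ℓ/2 − 2 log ℓ − 3.2243`, `ℓ = log q`. So the SUFFICIENT
Cramér constant of the edge block tends to `1⁻` (ATTEMPT-7 §3's `g_suff → (1 − o(1))√q log q`, now a theorem);
the method stops at `1`, where the polar cross mass `(c/2)·log q` reaches the lobe level `½·log q`. Nothing here
bears on RH. [this track, ATTEMPT-8 §3; cite: Bombieri2000, §12 eqs. (12.3)–(12.9)] -/
theorem edgeNonneg_of_gap_le' (hcons : ConsecutivePrimes q q') (hq : Real.exp 80 ≤ q) {c : ℝ}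
    (hc : 4 * Real.log (Real.log q) + 19 ≤ (1 - c) * Real.log q)
    (hgap : (q' : ℝ) - q ≤ c * Real.sqrt q * Real.log q) {η : ℝ} (hη : 0 < η) (hηq : η ≤ 1 / (4 * q)) :
    EdgeNonneg q q' η := by
  have hq0 : (0 : ℝ) < q := by exact_mod_cast hcons.1.pos
  have hqq' : (q : ℝ) < q' := by exact_mod_cast hcons.2.2.1
  have hq'0 : (0 : ℝ) < q' := hq0.trans hqq'
  have hℓ80 : 80 ≤ Real.log q := by rw [Real.le_log_iff_exp_le hq0]; exact hq
  have hℓ0 : 0 < Real.log q := by linarith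
  have h16 : Real.exp 16 ≤ q := (Real.exp_le_exp.2 (by norm_num)).trans hq
  have h7 : (10 : ℝ) ^ 7 ≤ q :=
    ten_pow_seven_le_exp_seventeen.trans ((Real.exp_le_exp.2 (by norm_num)).trans hq)
  have hsq : 0 < Real.sqrt q := Real.sqrt_pos.2 hq0
  have hsqsq : Real.sqrt q * Real.sqrt q = q := Real.mul_self_sqrt hq0.le
  have hsq1000 : (1000 : ℝ) ≤ Real.sqrt q := thousand_le_sqrt_of_exp_eighty_le hq
  have hlogℓ0 : 0 ≤ Real.log (Real.log q) := Real.log_nonneg (by linarith)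
  have hc1 : c ≤ 1 := by nlinarith
  have hg0 : 0 ≤ c * Real.sqrt q * Real.log q := by linarith
  have hc0 : 0 ≤ c := by
    by_contra h
    rw [not_le] at h
    have h1 : 0 < Real.sqrt q * Real.log q := mul_pos hsq hℓ0
    have h2 : c * (Real.sqrt q * Real.log q) < 0 := mul_neg_of_neg_of_pos h h1
    have h3 : c * Real.sqrt q * Real.log q = c * (Real.sqrt q * Real.log q) := by ring
    linarith [h2, h3.le]
  have hηsq : η * Real.sqrt q ≤ 0.00025 := eta_mul_sqrt_le hq0 hsq1000 hηq
  have hηsmall : η ≤ 0.001 := by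
    have : (1 : ℝ) / (4 * q) ≤ 0.001 := by
      rw [div_le_iff₀ (by positivity)]; linarith [h7]
    exact hηq.trans this
  have hη' : η < Real.log q / 2 := by linarith
  have hη2 : η < Real.log 2 / 2 := by have := Real.log_two_gt_d9; linarith
  set ℓ : ℝ := Real.log q with hℓ
  have hq1 : (1 : ℝ) ≤ q := by linarith [Real.one_le_exp (by norm_num : (0:ℝ) ≤ 16), h16]
  have hℓ4 : ℓ ^ 4 ≤ 384 * Real.sqrt q := log_pow_four_le_sqrt hq1
  have hℓ3 : 0 < ℓ ^ 3 := by positivity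
  have hlogdiff : Real.log q' - ℓ ≤ c * ℓ / Real.sqrt q := log_sub_log_le_of_gap hq0 hqq' hgap
  set K : ℝ := Real.sqrt q / ℓ ^ 2 with hK_def
  have hℓ2 : 0 < ℓ ^ 2 := by positivity
  have hK0 : 0 < K := div_pos hsq hℓ2
  have hK2 : 2 ≤ K := by
    rw [hK_def, le_div_iff₀ hℓ2]
    have h1 : ℓ ^ 2 ≤ 64 * (q : ℝ) ^ (1 / 4 : ℝ) := log_sq_le_sixtyfour_mul_rpow_quarter hq1
    have h2 : Real.sqrt q = (q : ℝ) ^ (1 / 4 : ℝ) * (q : ℝ) ^ (1 / 4 : ℝ) := by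
      rw [Real.sqrt_eq_rpow, ← Real.rpow_add hq0]; norm_num
    have h3 : Real.exp 20 ≤ (q : ℝ) ^ (1 / 4 : ℝ) := by
      have e : Real.exp 80 ^ (1 / 4 : ℝ) = Real.exp 20 := by rw [← Real.exp_mul]; norm_num
      rw [← e]; exact Real.rpow_le_rpow (Real.exp_pos 80).le hq (by norm_num)
    have h4 : (128 : ℝ) ≤ Real.exp 20 :=
      (by linarith [exp_seven_ge] : (128 : ℝ) ≤ Real.exp 7).trans (Real.exp_le_exp.2 (by norm_num))
    have h5 : 0 ≤ (q : ℝ) ^ (1 / 4 : ℝ) := Real.rpow_nonneg hq0.le _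
    calc 2 * ℓ ^ 2 ≤ 128 * (q : ℝ) ^ (1 / 4 : ℝ) := by linarith
      _ ≤ (q : ℝ) ^ (1 / 4 : ℝ) * (q : ℝ) ^ (1 / 4 : ℝ) := mul_le_mul_of_nonneg_right (h4.trans h3) h5
      _ = Real.sqrt q := h2.symm
  have hlogK : Real.log K = ℓ / 2 - 2 * Real.log ℓ := by
    rw [hK_def, Real.log_div hsq.ne' hℓ2.ne', Real.log_sqrt hq0.le, Real.log_pow]
    push_cast
    ring
  refine edgeNonneg_of_gapIneq_param hcons hη hη' hη2 fun b hb ↦ ⟨K, hK2, ?_⟩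
  set D : ℝ := b - (Real.log q / 2 - η) with hD_def
  have hD0 : 0 ≤ D := by simp only [hD_def]; linarith [hb.1]
  have hDle : D ≤ c * ℓ / (2 * Real.sqrt q) + η := by
    simp only [hD_def]
    have : c * ℓ / (2 * Real.sqrt q) = c * ℓ / Real.sqrt q / 2 := by ring
    linarith [hb.2, hlogdiff]
  have hcℓsq : c * ℓ / (2 * Real.sqrt q) ≤ 0.0004 := by
    -- cℓ ≤ ℓ and ℓ⁴ ≤ 384√q with ℓ ≥ 80: 512000·ℓ ≤ ℓ⁴ ≤ 384 √q
    rw [div_le_iff₀ (by positivity)]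
    have h1 : c * ℓ ≤ 1 * ℓ := mul_le_mul_of_nonneg_right hc1 hℓ0.le
    have h512 : (512000 : ℝ) ≤ ℓ ^ 3 := by
      have := pow_le_pow_left₀ (by norm_num) hℓ80 3
      linarith [this]
    have h2 : (512000 : ℝ) * ℓ ≤ ℓ ^ 4 := by
      calc (512000 : ℝ) * ℓ ≤ ℓ ^ 3 * ℓ := mul_le_mul_of_nonneg_right h512 hℓ0.le
        _ = ℓ ^ 4 := by ring
    linarith [h1, h2, hℓ4]
  have hDsmall : D ≤ 0.0024 := by linarith
  have hDK : D * K ≤ 1 / (2 * ℓ) + 0.00025 / ℓ ^ 2 := by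
    have h1 : D * K ≤ (c * ℓ / (2 * Real.sqrt q) + η) * K := mul_le_mul_of_nonneg_right hDle hK0.le
    have h2 : (c * ℓ / (2 * Real.sqrt q) + η) * K = c / (2 * ℓ) + η * Real.sqrt q / ℓ ^ 2 := by
      rw [hK_def]
      field_simp
    have h3 : c / (2 * ℓ) ≤ 1 / (2 * ℓ) := div_le_div_of_nonneg_right hc1 (by positivity)
    have h4 : η * Real.sqrt q / ℓ ^ 2 ≤ 0.00025 / ℓ ^ 2 := div_le_div_of_nonneg_right hηsq hℓ2.le
    linarith [h1, h2.le, h3, h4]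
  have hX := handoffCrossConst_le_of_gap_le' hcons hq hc1 hgap hη hηq hb
  have hlobe := lobeCoercivity_ge_of_level' hℓ80 hD0 hDsmall hK2 hlogK hDK
  show handoffCrossConst q η b ≤ lobeCoercivity D K
  have hcℓ : c / 2 * ℓ + 6.1154 ≤ ℓ / 2 - 2 * Real.log ℓ - 3.2243 := by linarith [hc, hlogℓ0]
  linarith [hX, hlobe, hcℓ]

/-- **Threshold form: `q ≥ exp(144/(1 − c)²)` suffices.** For `c < 1` and consecutive primes `q < q′` with
`exp(144/(1 − c)²) ≤ q`, a gap `q′ − q ≤ c·√q·log q` and an overlap `0 < η ≤ 1/(4q)` give `EdgeNonneg q q′ η`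
(`log ℓ ≤ 2√ℓ` turns `4 log ℓ + 19 ≤ (1 − c)ℓ` into `8√ℓ + 19 ≤ (1 − c)ℓ`, true once `(1 − c)√ℓ ≥ 12`). So for every
`c < 1`, «gaps `≤ c√p log p` from some point on» implies «the edge block from some (explicit) point on».
Nothing here bears on RH. [this track, ATTEMPT-8 §3] -/
theorem edgeNonneg_of_gap_le_of_exp_le (hcons : ConsecutivePrimes q q') {c : ℝ} (hc : c < 1)
    (hq : Real.exp (144 / (1 - c) ^ 2) ≤ q) (hgap : (q' : ℝ) - q ≤ c * Real.sqrt q * Real.log q)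
    {η : ℝ} (hη : 0 < η) (hηq : η ≤ 1 / (4 * q)) : EdgeNonneg q q' η := by
  have hq0 : (0 : ℝ) < q := by exact_mod_cast hcons.1.pos
  have hε : 0 < 1 - c := by linarith
  set ℓ : ℝ := Real.log q with hℓ
  have hℓA : 144 / (1 - c) ^ 2 ≤ ℓ := by rw [hℓ, Real.le_log_iff_exp_le hq0]; exact hq
  have hε2 : 0 < (1 - c) ^ 2 := by positivity
  have hℓ0 : 0 < ℓ := lt_of_lt_of_le (by positivity) hℓA
  have hprod : 144 ≤ (1 - c) ^ 2 * ℓ := by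
    have := (div_le_iff₀ hε2).1 hℓA; linarith
  have hsqrtℓ : 0 < Real.sqrt ℓ := Real.sqrt_pos.2 hℓ0
  have hsℓ : Real.sqrt ℓ * Real.sqrt ℓ = ℓ := Real.mul_self_sqrt hℓ0.le
  have h12 : 12 ≤ (1 - c) * Real.sqrt ℓ := by
    have h1 : (12 : ℝ) ^ 2 ≤ ((1 - c) * Real.sqrt ℓ) ^ 2 := by nlinarith [hprod, hsℓ]
    nlinarith [h1, mul_pos hε hsqrtℓ]
  have hqq' : (q : ℝ) < q' := by exact_mod_cast hcons.2.2.1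
  have hsq : 0 < Real.sqrt q := Real.sqrt_pos.2 hq0
  have hc0 : 0 ≤ c := by
    by_contra h
    rw [not_le] at h
    have : c * Real.sqrt q * Real.log q < 0 := by
      have := mul_pos hsq hℓ0
      rw [← hℓ]; nlinarith
    linarith
  have hℓ144 : 144 ≤ ℓ := by
    have : (1 - c) ^ 2 ≤ 1 := by nlinarith
    nlinarith [hprod, this]
  have hq80 : Real.exp 80 ≤ q := by
    rw [← Real.le_log_iff_exp_le hq0, ← hℓ]; linarith
  have hlogℓ : Real.log ℓ ≤ 2 * Real.sqrt ℓ := by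
    have h := Real.log_le_rpow_div hℓ0.le (by norm_num : (0:ℝ) < 1 / 2)
    rw [← Real.sqrt_eq_rpow] at h
    linarith
  refine edgeNonneg_of_gap_le' hcons hq80 ?_ hgap hη hηq
  rw [← hℓ]
  -- 4 log ℓ + 19 ≤ 8√ℓ + 19 ≤ (1-c)√ℓ · √ℓ = (1-c) ℓ  since (1-c)√ℓ ≥ 12 and √ℓ ≥ 12
  have hsqrt12 : 12 ≤ Real.sqrt ℓ := by
    have : (1 - c) * Real.sqrt ℓ ≤ Real.sqrt ℓ := by nlinarith
    linarith
  nlinarith [hlogℓ, h12, hsqrt12, hsℓ]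

end Summit.RiemannHypothesis.RiemannHypothesis.Theorems.Handoff
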